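import Literature.MathematicalPhysics.QuantumFieldTheory.Balaban1983to89.Node00.RStepSlotOfRecord
import Literature.MathematicalPhysics.QuantumFieldTheory.Balaban1983to89.B14Eq218SeqSucc

/-!
# NODE 00 — THE 𝐑-STEP RE-BOOKS CLASS WEIGHTS ALONG ITS SELECTOR: under the (0.3) provisos, the post-𝐑 class weight of a sequence is the sum of the
# pre-𝐑 class weights of its selector-preimage; hence a selector that PRESERVES THE PREFIX of every massive sequence (the identity; the live selector)
# conserves every `init`-fibre sum of class weights — the 𝐑-half of the class-wise telescoping of the (2.18) class weights

Cell `pub-ymgap`, YM-PLAN Track A (HUMAN RULING D-0062); author seat `pub-ymgap-dag-n20-d` (g37, the N20 lineage), on def-R's objects (`Node00/RStepRepr218`: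
`rstepOfSel`, `rterm`, `rratio`; `Node00/RStepSlotOfRecord`: `rstepSlot`, `sliceOfRecord`, `fibOfSeq`) and b01's PROVED fibre lemma (`B15BasicStep.integral_normTerm_eq`).
[IV] = [Balaban1989LargeFieldI]; [III] = [Balaban1988Convergent].

WHY.  [IV] (0.3) p. 176: «(𝐑ρ)(V) = Σ_Z ρ(Z″, V) ∫dV⌈_{Z′} ρ(Z, V) [∫dV⌈_{Z′} ρ(Z″, V)]⁻¹» — re-indexed by the selector `a ↦ a″ = sel a` (def-R's `rstepOfSel`), the new slot of `a′` is
`(𝐓e^A)(a′) · Σ_{sel a = a′} ∫⌈_{Z′(a)} t_a ∕ ∫⌈_{Z′(a)} t_{a′}`, and b01's (0.4) `integral_normTerm_eq` says that each summand INTEGRATES to `∫ t_a`.  So — under the printed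
provisos (pieces measurable, non-negative, bounded; denominators nowhere zero) — THE 𝐑-STEP RE-BOOKS CLASS WEIGHTS ALONG `sel`: `∫ χ(a′)·(𝐓e^A)′(a′) = Σ_{sel a = a′} ∫ t_a`
(§1 ★ `integral_chi_mul_rstepOfSel_TexpA`); consequently for ANY labelling `pre` of the index (e.g. `Seq.init`) and any label `q`, if `sel` preserves the label of every
sequence of non-zero mass, `Σ_{pre a′ = q} ∫ χ(a′)·(𝐓e^A)′(a′) = Σ_{pre a = q} ∫ t_a` (§1 ★★ `sum_filter_integral_chi_mul_rstepOfSel_TexpA`); at def-R's slots of record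
(§2 ★★ `sum_filter_integral_chi_mul_rstepSlot`, labelling `Seq.init`): the 𝐑-HALF of the class-wise telescoping law (T) of the N20 lineage's tower sockets
(`Summit…BlocksFreshTowerFaces`, hTA ∕ hTB), whose 𝐓-half is `Node00/TStepFibreMass`.  The identity selector preserves every prefix (`Or.inl rfl`); a
HISTORY-REWRITING selector ([IV] p. 177 (ii), `Z″ = Z ∖ Z′` removed from every entry) does NOT, and then the `init`-fibre sums are genuinely re-booked (the lineage's
LOCATED-2, 2026-08-30): the hypothesis `hsel` is exactly where that distinction enters.

WHAT IS PROVED (finite-sum algebra + b01's `integral_normTerm_eq` ∕ `integrable_normTerm`; def-R's TS-8 instance convention: the `DecidableEq (PBond P j)` instance is an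
explicit binder `iP` of the generic lemmas, instantiated by unification at the terms of record).
* §1 (generic over `Step.Repr218 P G j`, `sel`, `fib`): `chi_mul_rstepOfSel_TexpA_eq_sum_normTerm` (pointwise), ★ `integral_chi_mul_rstepOfSel_TexpA`,
  ★★ `sum_filter_integral_chi_mul_rstepOfSel_TexpA`.
* §2 (of record): ★★ `sum_filter_integral_chi_mul_rstepSlot` (labelling `Seq.init`; any selector preserving the prefix of massive sequences).

HONEST FRAMING.  Nothing of Bałaban's is asserted: the provisos of (0.3) (measurable, non-negative, bounded pieces; nowhere-vanishing denominators at the selected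
targets) and the prefix-preservation of the selector are HYPOTHESES; no estimate; no `Provisos` inhabitant claimed; the 𝐓-step is not touched; whether the record's tuple
carries a prefix-preserving selector is NOT decided here (director-ym №114 (α): the K0′ witness carries the LIVE selector; the (ρ2) pin is history-rewriting).  Counts
UNMOVED (typed 28∕28 · discharged 8∕27); one finite four-torus programme at fixed `ε` — NOT ℝ⁴ ∕ OS ∕ mass gap ∕ Clay.  No `def`, no `sorry`, no `axiom`, no
`instance`, no `notation`.
-/

noncomputable section

open MeasureTheory
open scoped BigOperators

namespace Literature.MathematicalPhysics.QuantumFieldTheory.Balaban1983to89.Node00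

open T4Continuum B14.Eq218Concrete B15RopTotal
open B15.BasicStep (fibreIntegral normTerm integral_normTerm_eq integrable_normTerm)

/-! ## §1 Generic: the 𝐑-step on a (2.18) representation re-books class weights along its selector -/

section Generic

variable {P : Params} {G : Type*} [GaugeGroup G] [MeasurableSpace G] [HaarData G] {j : ℕ}

open scoped Classical in
/-- POINTWISE: the new piece of `a′` is the sum over the selector-preimage of `a′` of b01's normalised replacement terms,
`χ(a′)(V)·(𝐓e^A)′(a′)(V) = Σ_{sel a = a′} t_{a′}(V)·∫⌈_{Z′(a)} t_a ∕ ∫⌈_{Z′(a)} t_{a′} = Σ_{sel a = a′} normTerm (fib a) t_{a′} t_a (V)` (`rstepOfSel_TexpA`, `rterm`, `rratio`,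
`normTerm` unfolded). [cite: Balaban1989LargeFieldI, (0.3) p.176] -/
theorem chi_mul_rstepOfSel_TexpA_eq_sum_normTerm (iP : DecidableEq (PBond P j)) (r : Step.Repr218 P G j) (sel : r.Adm → r.Adm)
    (fib : r.Adm → Finset (PBond P j)) (a' : r.Adm) (V : GaugeField P j G) :
    r.χ a' V * (rstepOfSel r sel fib).TexpA a' V =
      ∑ a ∈ Finset.univ.filter (fun a => sel a = a'), normTerm (fib a) (rterm r a') (rterm r a) V := by
  classical
  rw [rstepOfSel_TexpA, ← mul_assoc, Finset.mul_sum]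
  refine Finset.sum_congr rfl fun a _ => ?_
  rfl

open scoped Classical in
/-- ★ **THE 𝐑-STEP RE-BOOKS CLASS WEIGHTS ALONG ITS SELECTOR.**  Under the provisos of (0.3) on the terms `t_a = χ(a)·(𝐓e^A)(a)` (measurable, non-negative, bounded by
`C`) and nowhere-vanishing denominators at the selected targets (`∫⌈_{Z′(a)} t_{sel a} ≠ 0`), the post-𝐑 class weight of `a′` is the sum of the pre-𝐑 class weights of its
preimage: `∫ χ(a′)·(𝐓e^A)′(a′) = Σ_{sel a = a′} ∫ t_a` (b01's `integral_normTerm_eq` summand by summand). [cite: Balaban1989LargeFieldI, (0.3)–(0.4) p.176] -/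
theorem integral_chi_mul_rstepOfSel_TexpA (iP : DecidableEq (PBond P j)) (r : Step.Repr218 P G j) (sel : r.Adm → r.Adm)
    (fib : r.Adm → Finset (PBond P j)) (hm : ∀ a, Measurable (rterm r a)) (h0 : ∀ a V, 0 ≤ rterm r a V) {C : ℝ}
    (hC : ∀ a V, rterm r a V ≤ C) (hden : ∀ a V, fibreIntegral (fib a) (rterm r (sel a)) V ≠ 0) (a' : r.Adm) :
    ∫ V, r.χ a' V * (rstepOfSel r sel fib).TexpA a' V ∂(fieldMeasure P j G) =
      ∑ a ∈ Finset.univ.filter (fun a => sel a = a'), ∫ V, rterm r a V ∂(fieldMeasure P j G) := by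
  have hint : ∀ a ∈ Finset.univ.filter (fun a => sel a = a'),
      Integrable (normTerm (fib a) (rterm r a') (rterm r a)) (fieldMeasure P j G) := by
    intro a ha
    have hsa : sel a = a' := (Finset.mem_filter.1 ha).2
    exact integrable_normTerm (fib a) (hm a') (hm a) (h0 a') (hC a') (hC a) (fun V => hsa ▸ hden a V)
  calc ∫ V, r.χ a' V * (rstepOfSel r sel fib).TexpA a' V ∂(fieldMeasure P j G)
      = ∫ V, ∑ a ∈ Finset.univ.filter (fun a => sel a = a'), normTerm (fib a) (rterm r a') (rterm r a) V ∂(fieldMeasure P j G) :=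
        integral_congr_ae (ae_of_all _ fun V => chi_mul_rstepOfSel_TexpA_eq_sum_normTerm iP r sel fib a' V)
    _ = ∑ a ∈ Finset.univ.filter (fun a => sel a = a'), ∫ V, normTerm (fib a) (rterm r a') (rterm r a) V ∂(fieldMeasure P j G) :=
        integral_finsetSum _ hint
    _ = ∑ a ∈ Finset.univ.filter (fun a => sel a = a'), ∫ V, rterm r a V ∂(fieldMeasure P j G) := by
        refine Finset.sum_congr rfl fun a ha => ?_
        have hsa : sel a = a' := (Finset.mem_filter.1 ha).2
        exact integral_normTerm_eq (fib a) (hm a') (hm a) (h0 a') (h0 a) (hC a') (hC a) (fun V => hsa ▸ hden a V)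

open scoped Classical in
/-- ★★ **A PREFIX-PRESERVING SELECTOR CONSERVES EVERY LABELLED CLASS.**  With a labelling `pre` of the index (e.g. `Seq.init`) and a selector that preserves the label of
every sequence of non-zero mass (`pre (sel a) = pre a`, or `∫ t_a = 0`), under the provisos of `integral_chi_mul_rstepOfSel_TexpA`:
`Σ_{pre a′ = q} ∫ χ(a′)·(𝐓e^A)′(a′) = Σ_{pre a = q} ∫ t_a` for every label `q` — re-booking along a label-preserving map does not move mass between labels
(`Finset.sum_fiberwise_eq_sum_filter`).  The identity selector qualifies (`fun a => Or.inl rfl`); a history-rewriting one ([IV] p.177 (ii)) does not.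
[cite: Balaban1989LargeFieldI, (0.3)–(0.4) p.176, p.177 (ii)] -/
theorem sum_filter_integral_chi_mul_rstepOfSel_TexpA (iP : DecidableEq (PBond P j)) (r : Step.Repr218 P G j) (sel : r.Adm → r.Adm)
    (fib : r.Adm → Finset (PBond P j)) (hm : ∀ a, Measurable (rterm r a)) (h0 : ∀ a V, 0 ≤ rterm r a V) {C : ℝ}
    (hC : ∀ a V, rterm r a V ≤ C) (hden : ∀ a V, fibreIntegral (fib a) (rterm r (sel a)) V ≠ 0)
    {Q : Type*} (pre : r.Adm → Q) (hsel : ∀ a, pre (sel a) = pre a ∨ ∫ V, rterm r a V ∂(fieldMeasure P j G) = 0) (q : Q) :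
    ∑ a' ∈ Finset.univ.filter (fun a' => pre a' = q), ∫ V, r.χ a' V * (rstepOfSel r sel fib).TexpA a' V ∂(fieldMeasure P j G) =
      ∑ a ∈ Finset.univ.filter (fun a => pre a = q), ∫ V, rterm r a V ∂(fieldMeasure P j G) := by
  calc ∑ a' ∈ Finset.univ.filter (fun a' => pre a' = q), ∫ V, r.χ a' V * (rstepOfSel r sel fib).TexpA a' V ∂(fieldMeasure P j G)
      = ∑ a' ∈ Finset.univ.filter (fun a' => pre a' = q),
          ∑ a ∈ Finset.univ.filter (fun a => sel a = a'), ∫ V, rterm r a V ∂(fieldMeasure P j G) :=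
        Finset.sum_congr rfl fun a' _ => integral_chi_mul_rstepOfSel_TexpA iP r sel fib hm h0 hC hden a'
    _ = ∑ a ∈ Finset.univ.filter (fun a => sel a ∈ Finset.univ.filter (fun a' => pre a' = q)),
          ∫ V, rterm r a V ∂(fieldMeasure P j G) :=
        Finset.sum_fiberwise_eq_sum_filter _ _ _ _
    _ = ∑ a, if pre (sel a) = q then ∫ V, rterm r a V ∂(fieldMeasure P j G) else 0 := by
        rw [Finset.sum_filter]
        refine Finset.sum_congr rfl fun a _ => ?_
        simp only [Finset.mem_filter, Finset.mem_univ, true_and]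
    _ = ∑ a, if pre a = q then ∫ V, rterm r a V ∂(fieldMeasure P j G) else 0 := by
        refine Finset.sum_congr rfl fun a _ => ?_
        rcases hsel a with h | h
        · rw [h]
        · rw [h]
          split_ifs <;> rfl
    _ = ∑ a ∈ Finset.univ.filter (fun a => pre a = q), ∫ V, rterm r a V ∂(fieldMeasure P j G) := by
        rw [Finset.sum_filter]

end Generic

/-! ## §2 Of record: def-R's slots, labelling `Seq.init` -/

variable (F : T4Family) (N : ℕ) [NeZero N]

open scoped Classical in
/-- ★★ **THE 𝐑-STEP OF RECORD ON SLOTS CONSERVES EVERY `init`-FIBRE SUM OF CLASS WEIGHTS — for a selector that preserves the prefix of every massive sequence.**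
At def-R's slot face (`rstepSlot … sel f = (rstepOfSel (sliceOfRecord … f) sel (fibOfSeq …)).TexpA`, front factors `chiSeqOfRecord`, terms `t_s = χ_k(s)·f(s)`), under the
provisos of (0.3) on the terms (measurable, non-negative, bounded) and nowhere-vanishing denominators at the selected targets, and a selector `sel` with
`(sel s).init = s.init` or `∫ t_s = 0` for every `s`:  `Σ_{s′ : s′.init = π} ∫ χ_k(s′)·(rstepSlot … sel f)(s′) = Σ_{s′ : s′.init = π} ∫ χ_k(s′)·f(s′)`.  With the 𝐓-half
(`Node00/TStepFibreMass.sum_fiber_integral_chi_tstepOfRecord`) this is the class-wise telescoping (T) of the N20 lineage's tower sockets, at such selectors.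
[cite: Balaban1989LargeFieldI, (0.3)–(0.4) p.176, p.177 (ii)] -/
theorem sum_filter_integral_chi_mul_rstepSlot (ν : Stage7Numerics) (τ : TowerNumerics) (p : B12.RunParams) (g : ℕ → ℝ) (k : ℕ)
    (sel : SeqOfRecord F ν τ.M g p.K (k + 1) → SeqOfRecord F ν τ.M g p.K (k + 1)) (f : TexpASlot F N ν τ.M p g (k + 1))
    (hm : ∀ s, Measurable (fun V => chiSeqOfRecord F N ν τ.M g p.K (k + 1) s V * f s V))
    (h0 : ∀ s V, 0 ≤ chiSeqOfRecord F N ν τ.M g p.K (k + 1) s V * f s V) {C : ℝ}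
    (hC : ∀ s V, chiSeqOfRecord F N ν τ.M g p.K (k + 1) s V * f s V ≤ C)
    (hden : ∀ s V, fibreIntegral (fibOfSeq F ν τ p g (k + 1) s)
      (fun V => chiSeqOfRecord F N ν τ.M g p.K (k + 1) (sel s) V * f (sel s) V) V ≠ 0)
    (hsel : ∀ s, (sel s).init = s.init ∨
      ∫ V, chiSeqOfRecord F N ν τ.M g p.K (k + 1) s V * f s V ∂(fieldMeasure (F.P p.K) (k + 1) (SU N)) = 0)
    (π : SeqOfRecord F ν τ.M g p.K k) :
    ∑ s' ∈ Finset.univ.filter (fun s' : SeqOfRecord F ν τ.M g p.K (k + 1) => s'.init = π),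
        ∫ V, chiSeqOfRecord F N ν τ.M g p.K (k + 1) s' V * rstepSlot F N ν τ p g (k + 1) sel f s' V ∂(fieldMeasure (F.P p.K) (k + 1) (SU N)) =
      ∑ s' ∈ Finset.univ.filter (fun s' : SeqOfRecord F ν τ.M g p.K (k + 1) => s'.init = π),
        ∫ V, chiSeqOfRecord F N ν τ.M g p.K (k + 1) s' V * f s' V ∂(fieldMeasure (F.P p.K) (k + 1) (SU N)) := by
  unfold rstepSlot
  exact sum_filter_integral_chi_mul_rstepOfSel_TexpA _ (sliceOfRecord F N ν τ.M p g (k + 1) f) sel (fibOfSeq F ν τ p g (k + 1))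
    hm h0 hC hden Seq.init hsel π


/-! ## Erratum (v1.1, citation precision; ref-F READ-902 NIT-1, 2026-08-30)

In the docstrings above, «[IV] p. 177 (ii)» is cited next to «history-rewriting selector».  The printed (ii) on p. 177 of [Balaban1989LargeFieldI] is the COMPONENT-HISTORY
property of the class of components the ℝ-operation renormalises («(ii) in the preceding N renormalization steps no new large field regions were created inside this
component, and the previous regions contained in it satisfy the condition (i) on the corresponding scales»), NOT a definition of the selector.  Reading the (0.3) selection
`Z ↦ Z″ = Z ∖ Z′` (p. 176), with `Z′` the union of the components satisfying (i)–(ii), as a «history-rewriting» map ON THE INDEX OF RECORD (one that changes the prefix of a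
massive sequence) is this lineage's LOCATED-2 reading (cell bus, 2026-08-30), inferred from (0.3) p. 176 together with (i)–(ii) p. 177 — not a printed statement.  The
locator «p.177 (ii)» in the cite tags above should be read in that sense.  No declaration is affected. -/

end Literature.MathematicalPhysics.QuantumFieldTheory.Balaban1983to89.Node00

end
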